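import Summits.ValiantsHypothesis.ValiantsHypothesis.Theses.UlrichPadded
import Summits.ValiantsHypothesis.ValiantsHypothesis.Theorems.UlrichPaddedPermHypersurfaceFactorial
import Literature.Computability.AlgebraicComplexity.PermanentIrreducible
import Literature.RingTheory.MvPolynomial.KaltofenBoundsMatrixTools

/-!
# Line `nagata-multilinear-chart` for crux `RankOneTrivialisation` (stmt-ValiantsHypothesis-5667) — gen 2

Crux (the route's decl, concluded BY NAME by `RankOneTrivialisation_of` below):
`Summit.ValiantsHypothesis.ValiantsHypothesis.Theses.UlrichPadded.RankOneTrivialisation`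
(route `route-ValiantsHypothesis-UlrichPadded`, rank 3; declared dependency crux 5666
`PermHypersurfaceFactorial` — CLOSED `proved` by
`Summit.ValiantsHypothesis.Theorems.permHypersurfaceFactorial_proof`,
file `Theorems/UlrichPaddedPermHypersurfaceFactorial.lean`):

  `∀ n ≥ 3, ∀ m (A : m × m over ℂ[x_ij]), IsAffineDetRepr per_n A →
     ∃ c w dc dw, dc + dw ≤ m − 1 ∧ deg cᵢ ≤ dc ∧ deg wⱼ ≤ dw ∧ ∀ i j, adj A i j − cᵢ wⱼ ∈ (per_n)`

("the adjugate of every affine determinantal representation of `per_n` is an outer product modulo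
`per_n`, with the sharp degree budget `m − 1`").

Skeleton of crux idea `Ideas/nagata-multilinear-chart.md` (ideator 1; triage r1-1 / r1-2 / r1-3: pass,
"strongest card"; merge group with `nagata-permanental-minor`).  The card's lever is Klein–Nagata for
the permanent (`per_n = x₀₀·α + Q`, chart `S_n[1/ᾱ] ≅ ℂ[x∖x₀₀][1/α]`, so `S_n = ℂ[x]/(per_n)` is a UFD
once `ᾱ` is prime) and "once `S_n` is a UFD the crux is gcd-extraction of the rank-one matrix
`adj A mod per_n` and the degree budget is automatic".  The panel's unanimous sharpening ("for THIS
crux keep only the downstream; the chart / `CofactorPrime` / height-≥-3 upstream is crux-5666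
material") became decisive when crux 5666 LANDED: the card's Transfer `C⁺ = PermRingUFD`
("`S_n` is a UFD for `n ≥ 3`") is the sorry-free tree theorem
`Summit.ValiantsHypothesis.Theorems.permQuot_isDomain_and_ufm` (imported and USED below, not stubbed).
So the line is exactly the card's downstream, cut into three REGISTERED stubs, each a general lemma
over Mathlib declarations only (no permanent in any stub — everything per-specific is already proved):

1. `stub_adjugate_twoByTwo_of_det_eq_zero` (linear algebra over a domain): `det B = 0` ⇒ every
   `2 × 2` minor of `adj B` vanishes.  Applied to `Ā = A mod per_n` (`det Ā = per_n‾ = 0`).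
2. `stub_ufdOuterProduct` (the card's gcd extraction, over any UFD): a square matrix all of whose
   `2 × 2` minors vanish is an outer product `B i j = c i * w j`.  FACTORIALITY is consumed here —
   false over the non-factorial quadric cone `S_2` (Disproof's `A₂`).
3. `stub_degreeBudget_mod_homogeneous_prime` (graded bookkeeping; any field `K`, any homogeneous
   prime `f`, any entrywise degree bound `D`): ANY factorisation `B ≡ c' w'ᵀ (mod f)` of a matrix
   with entries of degree `≤ D` can be re-chosen with `dc + dw ≤ D` — `K[σ]/(f)` is a graded DOMAIN,
   reduced degrees add.  Instantiated with `D = m − 1`.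

gen-2 delta (planner-cruxplan-…-nagata-multilinear-c-g2-0, superseding gen 1's cut of the same line,
skeleton `cbd85e60d699`): gen 1's stub 3 `stub_gradedOuterProductBudget` bundled the bound
`deg (adj A)_{ij} ≤ m − 1` for affine `A` with the graded normalisation; that bound is PROVED in the
tree (`Literature.RingTheory.MvPolynomial.KaltofenBounds.totalDegree_adjugate_le`), so it now lives in
the sorry-free composition (this is where AFFINENESS is consumed) and stub 3 is the general lemma with
an arbitrary bound `D` — name and signature IDENTICAL to stub 4 of the sibling line
`Lines/pic-not-cl.lean`, just as stub 1 is identical (name + signature) to pic-not-cl's stub 2: one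
proof of either serves both lines.  gen 1's `stub_adjugateRankOne` = stub 1 here (renamed only);
`stub_ufdOuterProduct` is unchanged.

`RankOneTrivialisation_of` composes them (kernel-checked; `rankOneTrivialisation_of_parts` is the
implication `stub₁ → stub₂ → stub₃ → crux-unfolded`, sorry-free, axioms `propext`, `Classical.choice`,
`Quot.sound`): `S_n` is a domain and a UFD for `n ≥ 3` (`permQuot_isDomain_and_ufm` — this is where
`3 ≤ n` is consumed), `det Ā = 0` (`RingHom.map_det`), minors of `adj Ā` vanish (1), `adj Ā = c̄·w̄ᵀ`
over the UFD `S_n` (2), `adj Ā = (adj A)‾` (`RingHom.map_adjugate`), lift the factors,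
`deg (adj A)_{ij} ≤ m − 1` (`totalDegree_adjugate_le`, affineness), normalise degrees (3) with
`f = per_n`, homogeneous (`perPoly_isHomogeneous`) and prime (`perPoly_irreducible`), `D = m − 1`.

Disproof.lean (cdisprove-5667, `Cruxes/RankOneTrivialisation/Disproof.lean`, rc 0 sorry-free; verdict
"crux RESISTS — theorem given 5666", whose paper proof is this line in kernel-sheaf language) honoured:
* `rankOneTrivialisation_false_without_three_le` (witness `A₂`, `n = 2`; LANDED as
  `Summit.ValiantsHypothesis.Theorems.RankOneTrivialisationNegative.rankOneTrivialisation_false_at_two`):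
  `3 ≤ n` is consumed in the composition at `permQuot_isDomain_and_ufm (hn : 3 ≤ n)` feeding stub 2 —
  `S_2` is a domain but not a UFD, and `adj Ā₂` is rank one but NOT an outer product over `S_2`;
  no stub carries `3 ≤ n` because no stub is about the permanent.
* `rankOneTrivialisation_false_without_affine` (witness `N₃`; LANDED as
  `…RankOneTrivialisationNegative.rankOneTrivialisation_false_nonaffine`): affineness is consumed in
  the composition at `totalDegree_adjugate_le A 1 hA.1` (`D = m − 1`); for `N₃` (entries of degree `3`)
  only `D = 3(m − 1) = 3` is available and `dc + dw = 3` is indeed attained — stub 3 with the honest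
  `D` stays true, the crux's `m − 1` fails, as it must.
* `rankOneTrivialisation_tight_at_Bpp` / `_sharper_false` / `_grenetDegrees_false`: the line outputs
  `dc + dw ≤ D = m − 1` and nothing sharper; stub 3 with any bound `< D` in the conclusion is FALSE
  (`Bpp`, `D = 6`).
* `noTightInfinity_false` (= negatives index stmt-5668) and the other negatives (0340, 3735, 3738):
  no stub speaks about `j`, linear parts, optimal size or uniqueness of representations.
No stub is an instance of a landed Negative lemma
(`Theorems/UlrichPaddedRankOneTrivialisationNegativeLoadBearing.lean`: both lemmas there refute the
crux with a hypothesis DROPPED; the stubs are general algebra over arbitrary domains / UFDs /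
homogeneous primes and neither drops nor needs those hypotheses).
-/

noncomputable section

namespace Summit.ValiantsHypothesis.ValiantsHypothesis.Cruxes.RankOneTrivialisation.NagataMultilinearChart

open MvPolynomial Matrix Literature.Computability.AlgebraicComplexity

set_option linter.unusedVariables false
set_option linter.dupNamespace false

/-! ## Registered stubs (three general lemmas; `sorry` only here) -/

/-- **Stub 1 — the adjugate of a singular matrix over a domain has rank `≤ 1`** (size S–M, pure
Mathlib; name and signature identical to stub 2 of the sibling line `Lines/pic-not-cl.lean`).
For a square matrix `B` over an integral domain `S` with `det B = 0`, every `2 × 2` minor of `adj B`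
vanishes.  Why true: over `K = Frac S`, `B · adj B = det B · 1 = 0`, so the columns of `adj B` lie
in `ker B`; if `adj B ≠ 0` some `(m−1)`-minor is nonzero, `rank B = m − 1` and `ker B` is a line
(rank–nullity), so any two columns of `adj B` are proportional; if `adj B = 0` there is nothing to
show.  (Equivalently Jacobi: a `2 × 2` minor of `adj B` is `det B` times the complementary
`(m−2)`-minor.)  Degenerate sizes: `m = 0` vacuous, `m = 1` one index, `m = 2` the only minor is
`da − bc = det` (`Matrix.adjugate_fin_two`).  Tools: `Matrix.mul_adjugate`, `RingHom.map_adjugate` /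
`RingHom.map_det` along the injective `algebraMap S (FractionRing S)`, `Matrix.rank`,
`Matrix.exists_mulVec_eq_zero_iff`, `LinearMap.finrank_range_add_finrank_ker`, `finrank_eq_one_iff'`;
tree `Literature.Computability.AlgebraicComplexity.VonZurGathen.adjugate_eq_zero_of_rank_lt`
(VonZurGathenRegularity.lean) for the branch `rank B ≤ m − 2`. [folklore] -/
theorem stub_adjugate_twoByTwo_of_det_eq_zero :
    ∀ (S : Type) [CommRing S] [IsDomain S] (m : ℕ) (B : Matrix (Fin m) (Fin m) S),
      B.det = 0 → ∀ i j k l : Fin m, B.adjugate i j * B.adjugate k l = B.adjugate i l * B.adjugate k j := by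
  sorry

/-- **Stub 2 — over a UFD a rank-one matrix is an outer product** (size M, pure Mathlib; the gcd
extraction of the card — the step that consumes FACTORIALITY, i.e. where the landed crux 5666 and
hence `3 ≤ n` enter the crux).  If all `2 × 2` minors of `B` vanish over a UFD `R`, then
`B i j = c i * w j` for some vectors `c, w`.  Why true: if `B = 0` take `c = w = 0` (covers `m = 0`).
Otherwise pick a nonzero column `j₀`, let `g` be a gcd of its entries and `c := (column j₀)/g`
(primitive: the gcd of the `cᵢ` is a unit).  For every column `j` and a row `k` with `B k j₀ ≠ 0` the
minor relations give `B k j₀ · (column j) = B k j · (column j₀)`, so `column j = μⱼ · c` with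
`μⱼ = g · B k j / B k j₀ ∈ Frac R` (independent of `k` by the minor relations again); as `μⱼ cᵢ ∈ R`
for all `i` and `c` is primitive, `μⱼ ∈ R` (UFD: a reduced denominator dividing every `μⱼ cᵢ`
divides every `cᵢ`).  Put `w j := μⱼ` (so `w j₀ = g`).  Typeclass context: Mathlib's
`UniqueFactorizationMonoid R` over `[CommRing R]` carries `IsCancelMulZero R`; the only non-domain
instance is the zero ring, where the statement is trivial (`cases subsingleton_or_nontrivial R`, then
`IsDomain R` from `NoZeroDivisors` + `Nontrivial`).  FALSE over non-factorial domains — e.g.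
`adj Ā₂ = [[x̄₁₁, x̄₀₁], [−x̄₁₀, x̄₀₀]]` over the quadric cone `S_2 = ℂ[x]/(x₀₀x₁₁ + x₀₁x₁₀)`
(Disproof's `A₂`: the column module is the non-principal ruling).  Tools:
`UniqueFactorizationMonoid.toNormalizedGCDMonoid` / `Finset.gcd`, `Finset.extract_gcd` (primitive
vector), `Finset.gcd_dvd`, `IsFractionRing` / `IsLocalization.mk'`,
`UniqueFactorizationMonoid.dvd_of_dvd_mul_left_of_no_prime_factors` (or `Nat.Coprime`-style
`IsRelPrime.dvd_of_dvd_mul_left`). [folklore] -/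
theorem stub_ufdOuterProduct :
    ∀ (R : Type) [CommRing R] [UniqueFactorizationMonoid R] (m : ℕ) (B : Matrix (Fin m) (Fin m) R),
      (∀ i j k l : Fin m, B i j * B k l = B i l * B k j) →
        ∃ c w : Fin m → R, ∀ i j, B i j = c i * w j := by
  sorry

/-- **Stub 3 — degree budget modulo a homogeneous prime** (size M–L, generic graded algebra; name
and signature identical to stub 4 of the sibling line `Lines/pic-not-cl.lean`).  Let `f ∈ K[σ]` be a
prime form (homogeneous of some degree `e`), `B` an `m × m` matrix with all entries of total degree
`≤ D`, and suppose `B ≡ c' w'ᵀ (mod f)` entrywise for SOME vectors `c', w'`.  Then there are `c, w`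
and `dc + dw ≤ D` with `deg cᵢ ≤ dc`, `deg wⱼ ≤ dw` and still `B ≡ c wᵀ (mod f)`.  Why true:
`(f)` is a homogeneous ideal (`p ∈ (f) ⇒` every homogeneous component `p_a = f · k_{a−e} ∈ (f)`,
tree `homogeneousComponent_mul_of_isHomogeneous`, PencilFamily.lean) and prime, so for `p ∉ (f)` the
reduced degree `δ(p) := max {a : p_a ∉ (f)}` depends only on `p mod f`, satisfies
`δ(p) ≤ totalDegree p`, and is ADDITIVE: `(pq)_{δp+δq} ≡ p_{δp} q_{δq} ≢ 0 (mod f)` and all higher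
components of `pq` lie in `(f)`.  If some row index has `c'ᵢ ∈ (f)` for all `i`, or `w'ⱼ ∈ (f)` for
all `j`, then `B ≡ 0` and `c = w = 0`, `dc = dw = 0` works (also covers `m = 0`).  Otherwise put
`dc := max δ(c'ᵢ)`, `dw := max δ(w'ⱼ)` over the entries `∉ (f)`, attained at `i*, j*`; then
`dc + dw = δ(c'_{i*} w'_{j*}) = δ(B_{i*j*}) ≤ totalDegree B_{i*j*} ≤ D`, and replace each `c'ᵢ ∉ (f)`
by its truncation `Σ_{a ≤ δ(c'ᵢ)} (c'ᵢ)_a` (the dropped components lie in `(f)`, so the class is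
unchanged and the total degree is `≤ δ(c'ᵢ) ≤ dc`), each `c'ᵢ ∈ (f)` by `0`; same for `w'`.  SHARP: no
bound below `D` holds in general (Disproof `rankOneTrivialisation_tight_at_Bpp`: `B = adj Bpp`,
`D = m − 1 = 6`).  Tools: `MvPolynomial.homogeneousComponent`, `sum_homogeneousComponent`,
`homogeneousComponent_eq_zero`, `homogeneousComponent_isHomogeneous`, `IsHomogeneous.totalDegree_le`,
`totalDegree_finset_sum` / `totalDegree_mul`, `Ideal.mem_span_singleton`, `Prime.dvd_or_dvd`,
`Finset.exists_max_image`; tree `homogeneousComponent_mul_of_isHomogeneous` (PencilFamily.lean),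
`Literature.RingTheory.GradedAlgebra.quotGrading` (optional: the quotient grading by a homogeneous
ideal), Disproof.lean's pattern in `rankOneTrivialisation_tight_at_Bpp`. [folklore] -/
theorem stub_degreeBudget_mod_homogeneous_prime :
    ∀ (σ K : Type) [Field K] (f : MvPolynomial σ K) (e : ℕ), f.IsHomogeneous e → Prime f →
      ∀ (m D : ℕ) (B : Matrix (Fin m) (Fin m) (MvPolynomial σ K)),
        (∀ i j, (B i j).totalDegree ≤ D) →
        ∀ (c' w' : Fin m → MvPolynomial σ K), (∀ i j, B i j - c' i * w' j ∈ Ideal.span {f}) →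
          ∃ (c w : Fin m → MvPolynomial σ K) (dc dw : ℕ), dc + dw ≤ D ∧
            (∀ i, (c i).totalDegree ≤ dc) ∧ (∀ i, (w i).totalDegree ≤ dw) ∧
            ∀ i j, B i j - c i * w j ∈ Ideal.span {f} := by
  sorry

/-! ## Kernel-checked composition -/

/-- **Composition of the line (sorry-free in itself): `stub₁ → stub₂ → stub₃ → crux` (unfolded).**
Per-specific inputs, all PROVED in the tree: `S_n = ℂ[x]/(per_n)` is a domain and a UFD for `n ≥ 3`
(`Summit.ValiantsHypothesis.Theorems.permQuot_isDomain_and_ufm`, the UFD form of the closed crux 5666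
— this is where `3 ≤ n` is consumed), `per_n` is homogeneous (`perPoly_isHomogeneous`) and prime
(`perPoly_irreducible`), and the cofactors of an affine `m × m` matrix have total degree `≤ m − 1`
(`Literature.RingTheory.MvPolynomial.KaltofenBounds.totalDegree_adjugate_le` — this is where
AFFINENESS is consumed).  Steps: reduce `A` modulo `per_n` (`Ā := mk.mapMatrix A`),
`det Ā = per_n‾ = 0` (`RingHom.map_det`), so the `2 × 2` minors of `adj Ā` vanish (stub 1);
`adj Ā = c̄ w̄ᵀ` over the UFD `S_n` (stub 2); `adj Ā = (adj A)‾` (`RingHom.map_adjugate`), lift `c̄, w̄`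
to polynomials, and normalise degrees with `D = m − 1` (stub 3 with `f = per_n`).  The conclusion is
the crux UNFOLDED, so that exactly one theorem of this file, `RankOneTrivialisation_of`, concludes
the crux by name. [folklore] -/
theorem rankOneTrivialisation_of_parts
    (h2x2 : ∀ (S : Type) [CommRing S] [IsDomain S] (m : ℕ) (B : Matrix (Fin m) (Fin m) S),
      B.det = 0 → ∀ i j k l : Fin m, B.adjugate i j * B.adjugate k l = B.adjugate i l * B.adjugate k j)
    (hO : ∀ (R : Type) [CommRing R] [UniqueFactorizationMonoid R] (m : ℕ) (B : Matrix (Fin m) (Fin m) R),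
      (∀ i j k l : Fin m, B i j * B k l = B i l * B k j) →
        ∃ c w : Fin m → R, ∀ i j, B i j = c i * w j)
    (hB : ∀ (σ K : Type) [Field K] (f : MvPolynomial σ K) (e : ℕ), f.IsHomogeneous e → Prime f →
      ∀ (m D : ℕ) (B : Matrix (Fin m) (Fin m) (MvPolynomial σ K)),
        (∀ i j, (B i j).totalDegree ≤ D) →
        ∀ (c' w' : Fin m → MvPolynomial σ K), (∀ i j, B i j - c' i * w' j ∈ Ideal.span {f}) →
          ∃ (c w : Fin m → MvPolynomial σ K) (dc dw : ℕ), dc + dw ≤ D ∧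
            (∀ i, (c i).totalDegree ≤ dc) ∧ (∀ i, (w i).totalDegree ≤ dw) ∧
            ∀ i j, B i j - c i * w j ∈ Ideal.span {f}) :
    ∀ n : ℕ, 3 ≤ n → ∀ (m : ℕ) (A : Matrix (Fin m) (Fin m) (MvPolynomial (Fin n × Fin n) ℂ)),
      IsAffineDetRepr (perPoly (Fin n) ℂ) A →
      ∃ (c w : Fin m → MvPolynomial (Fin n × Fin n) ℂ) (dc dw : ℕ), dc + dw ≤ m - 1 ∧
        (∀ i, (c i).totalDegree ≤ dc) ∧ (∀ i, (w i).totalDegree ≤ dw) ∧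
        ∀ i j, A.adjugate i j - c i * w j ∈ Ideal.span {perPoly (Fin n) ℂ} := by
  intro n hn m A hA
  -- the permanental ring `S_n` is a domain and a UFD (closed crux 5666, UFD form, PROVED in the tree);
  -- this is the only place `3 ≤ n` is used
  set I : Ideal (MvPolynomial (Fin n × Fin n) ℂ) := Ideal.span {perPoly (Fin n) ℂ} with hI
  obtain ⟨hdom, hufm⟩ := Summit.ValiantsHypothesis.Theorems.permQuot_isDomain_and_ufm hn
  -- `per_n` is a homogeneous prime
  haveI : Nonempty (Fin n) := ⟨⟨0, by omega⟩⟩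
  have hprime : Prime (perPoly (Fin n) ℂ) := (perPoly_irreducible (n := Fin n) (R := ℂ)).prime
  have hhom : (perPoly (Fin n) ℂ).IsHomogeneous (Fintype.card (Fin n)) := perPoly_isHomogeneous
  -- `Ā = A mod per_n` is singular
  set Ab : Matrix (Fin m) (Fin m) (MvPolynomial (Fin n × Fin n) ℂ ⧸ I) :=
    (Ideal.Quotient.mk I).mapMatrix A with hAb
  have hdet : Ab.det = 0 := by
    rw [hAb, ← RingHom.map_det, hA.2]
    exact Ideal.Quotient.eq_zero_iff_mem.mpr (Ideal.subset_span rfl)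
  -- stub 1: the `2 × 2` minors of `adj Ā` vanish
  have hmin : ∀ i j k l : Fin m,
      Ab.adjugate i j * Ab.adjugate k l = Ab.adjugate i l * Ab.adjugate k j :=
    h2x2 (MvPolynomial (Fin n × Fin n) ℂ ⧸ I) m Ab hdet
  -- stub 2: `adj Ā` is an outer product over the UFD `S_n`
  obtain ⟨c', w', hcw⟩ := hO (MvPolynomial (Fin n × Fin n) ℂ ⧸ I) m Ab.adjugate hmin
  -- lift the factors to polynomials
  choose c₀ hc₀ using fun i => Ideal.Quotient.mk_surjective (c' i)
  choose w₀ hw₀ using fun j => Ideal.Quotient.mk_surjective (w' j)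
  have hadj : Ab.adjugate = (Ideal.Quotient.mk I).mapMatrix A.adjugate := by
    rw [hAb, RingHom.map_adjugate]
  have hlift : ∀ i j, A.adjugate i j - c₀ i * w₀ j ∈ I := by
    intro i j
    refine Ideal.Quotient.eq.mp ?_
    rw [map_mul, hc₀ i, hw₀ j, ← hcw i j, hadj, RingHom.mapMatrix_apply, Matrix.map_apply]
  -- affineness: the cofactors of an affine `m × m` matrix have total degree `≤ m − 1` (tree, PROVED);
  -- this is the only place `hA.1` (entries of degree `≤ 1`) is used
  have hdeg : ∀ i j, (A.adjugate i j).totalDegree ≤ m - 1 := by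
    intro i j
    have h := Literature.RingTheory.MvPolynomial.KaltofenBounds.totalDegree_adjugate_le A 1 hA.1 i j
    rwa [Fintype.card_fin, mul_one] at h
  -- stub 3: normalise the degrees of the factors within the budget `D = m − 1`
  exact hB (Fin n × Fin n) ℂ (perPoly (Fin n) ℂ) (Fintype.card (Fin n)) hhom hprime m (m - 1)
    A.adjugate hdeg c₀ w₀ hlift

/-- **The skeleton concludes the crux BY NAME**: `UlrichPadded.RankOneTrivialisation`
(stmt-ValiantsHypothesis-5667) from the three registered stubs (and the landed crux 5666). -/
theorem RankOneTrivialisation_of :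
    Summit.ValiantsHypothesis.ValiantsHypothesis.Theses.UlrichPadded.RankOneTrivialisation :=
  rankOneTrivialisation_of_parts stub_adjugate_twoByTwo_of_det_eq_zero stub_ufdOuterProduct
    stub_degreeBudget_mod_homogeneous_prime

end Summit.ValiantsHypothesis.ValiantsHypothesis.Cruxes.RankOneTrivialisation.NagataMultilinearChart

end
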